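import Mathlib

/-!
# IsotypicProjector — the `𝐅`-diagonal idempotent is a polynomial in the `𝐅`-actions (T4-A)

Seat p3 of the blind cell `pub-hodge-repro2` (Tier 4, README §6).  Nothing here depends on any
other file of the cell.  Companion of `KunnethProjector.lean`: together they exhibit the
projector onto the Weil line as an element of the ring of algebraic correspondences.

The second factor of the projector of `H⁴(B, ℚ)` onto the Weil line
`W_𝐅(B) = H¹(A₁) ⊗_𝐅 H¹(A₂) ⊗_𝐅 H¹(A₃) ⊗_𝐅 H¹(A₄)` is the `𝐅`-DIAGONAL idempotent of
`𝐅 ⊗_ℚ 𝐅 ⊗_ℚ 𝐅 ⊗_ℚ 𝐅` acting through the four commuting `𝐅`-actions `ρ_i(a) = (1, …, a, …, 1)^*`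
(pull-backs by endomorphisms of `B`, hence algebraic correspondences).  For two commuting actions
`ρ₁, ρ₂` of a field `𝐅 ⊇ ℚ` on a ℚ-vector space `V` the space splits into the COMPONENTS
`V_s = {v | ρ₂(a) v = ρ₁(s a) v ∀ a}` indexed by the ℚ-algebra endomorphisms `s` of `𝐅` (for
`𝐅/ℚ` Galois: `𝐅 ⊗_ℚ 𝐅 ≅ ∏_{s ∈ Gal} 𝐅`, so the components for `s ∈ Gal(𝐅/ℚ)` span `V`), the
diagonal component `V_id` (where both actions agree) being the `𝐅`-tensor product.  This file
proves, for a finite family `s_i` of twists with `s_{i₀} = id` and a SEPARATING element `θ`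
(`s_i θ ≠ θ` for `i ≠ i₀` — e.g. a primitive element of `𝐅/ℚ` when the `s_i` are the Galois
automorphisms), that the explicit operator

  `e := ρ₁(c⁻¹) · Q(ρ₂ θ)`,  `Q(X) = ∏_{i ≠ i₀} (X − s_i θ) ∈ 𝐅[X]` (coefficients through `ρ₁`),
  `c = Q(θ) = ∏_{i ≠ i₀} (θ − s_i θ) ≠ 0`,

is the identity on `V_{id}`, zero on every `V_{s_i}` with `i ≠ i₀`
(`isotypicProjector_apply_of_mem_component_self`, `isotypicProjector_apply_of_mem_component_ne`),
lies in the ℚ-subalgebra generated by `ρ₁(𝐅) ∪ ρ₂(𝐅)` (`isotypicProjector_mem_adjoin` — the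
algebraicity), and, under the decomposition hypothesis `IsIsotypicDecomposition`, is the
idempotent with range `V_{id}` (`isotypicProjector_idem`, `range_isotypicProjector`).  The
four-factor idempotent of the transfer is the composite of three such projectors (pairs
`(1,2)`, `(1,3)`, `(1,4)`); the file treats one pair.

Axioms: propext, Classical.choice, Quot.sound.
-/

namespace Summit.Ventures.HodgeRepro2.IsotypicProjector

open Polynomial Module

variable {F V : Type*} [Field F] [Algebra ℚ F] [AddCommGroup V] [Module ℚ V]

/-- Two commuting actions of the field `F` on the ℚ-vector space `V` (for the transfer:
`ρ₁(a) = (a,1,1,1)^*`, `ρ₂(a) = (1,a,1,1)^*` on `H⁴(B, ℚ)`). -/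
structure TwoActions (F V : Type*) [Field F] [Algebra ℚ F] [AddCommGroup V] [Module ℚ V] where
  /-- The first action. -/
  ρ₁ : F →ₐ[ℚ] Module.End ℚ V
  /-- The second action. -/
  ρ₂ : F →ₐ[ℚ] Module.End ℚ V
  /-- The two actions commute. -/
  comm : ∀ a b, ρ₁ a * ρ₂ b = ρ₂ b * ρ₁ a

namespace TwoActions

variable (A : TwoActions F V)

/-- Commutation, applied to a vector. -/
theorem comm_apply (a b : F) (v : V) : A.ρ₁ a (A.ρ₂ b v) = A.ρ₂ b (A.ρ₁ a v) := by
  have := congrArg (fun f : Module.End ℚ V => f v) (A.comm a b)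
  simpa [Module.End.mul_apply] using this

/-- The `s`-COMPONENT of `V`: the vectors on which the second action is the first action twisted
by the ℚ-algebra endomorphism `s` of `F`.  For `s = id` this is the `F`-diagonal part
(`H¹(A₁) ⊗_F H¹(A₂)` inside `H¹(A₁) ⊗_ℚ H¹(A₂)`). -/
def component (s : F →ₐ[ℚ] F) : Submodule ℚ V where
  carrier := {v | ∀ a, A.ρ₂ a v = A.ρ₁ (s a) v}
  zero_mem' := by intro a; simp
  add_mem' := by
    intro v w hv hw a
    simp [map_add, hv a, hw a]
  smul_mem' := by
    intro q v hv a
    simp [map_smul, hv a]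

/-- Membership in a component. -/
theorem mem_component_iff (s : F →ₐ[ℚ] F) (v : V) :
    v ∈ A.component s ↔ ∀ a, A.ρ₂ a v = A.ρ₁ (s a) v := Iff.rfl

/-- The first action preserves every component. -/
theorem ρ₁_mem_component {s : F →ₐ[ℚ] F} {v : V} (hv : v ∈ A.component s) (x : F) :
    A.ρ₁ x v ∈ A.component s := by
  intro a
  rw [← A.comm_apply, hv a, ← Module.End.mul_apply, ← map_mul, mul_comm, map_mul,
    Module.End.mul_apply]

/-- Powers of the second action on a component are the first action on powers. -/
theorem pow_ρ₂_apply {s : F →ₐ[ℚ] F} {v : V} (hv : v ∈ A.component s) (θ : F) (k : ℕ) :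
    (A.ρ₂ θ ^ k) v = A.ρ₁ (s θ ^ k) v := by
  induction k with
  | zero => simp
  | succ k ih =>
    rw [pow_succ', Module.End.mul_apply, ih, ← A.comm_apply, hv θ, ← Module.End.mul_apply,
      ← map_mul, pow_succ]

/-- POLYNOMIALS IN `ρ₂ θ` WITH COEFFICIENTS THROUGH `ρ₁`, on a component: `Q(ρ₂ θ) v = ρ₁(Q(s θ)) v`
for `v ∈ V_s`. -/
theorem eval₂_apply_of_mem_component {s : F →ₐ[ℚ] F} {v : V} (hv : v ∈ A.component s) (θ : F)
    (Q : F[X]) : (Q.eval₂ (A.ρ₁ : F →+* Module.End ℚ V) (A.ρ₂ θ)) v = A.ρ₁ (Q.eval (s θ)) v := by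
  induction Q using Polynomial.induction_on' with
  | add p q hp hq =>
    rw [eval₂_add, eval_add, map_add, LinearMap.add_apply, hp, hq, LinearMap.add_apply]
  | monomial n a =>
    rw [eval₂_monomial, eval_monomial, Module.End.mul_apply, A.pow_ρ₂_apply hv θ n]
    change (A.ρ₁ a * A.ρ₁ (s θ ^ n)) v = _
    rw [← map_mul]

end TwoActions

section Separating

variable {ι : Type*} [Fintype ι] [DecidableEq ι]

/-- The separating polynomial `Q(X) = ∏_{i ≠ i₀} (X − s_i θ)`. -/
noncomputable def separatingPolynomial (s : ι → (F →ₐ[ℚ] F)) (i₀ : ι) (θ : F) : F[X] :=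
  ∏ i ∈ Finset.univ.erase i₀, (X - C (s i θ))

/-- The constant `c = Q(θ) = ∏_{i ≠ i₀} (θ − s_i θ)`. -/
noncomputable def separatingConstant (s : ι → (F →ₐ[ℚ] F)) (i₀ : ι) (θ : F) : F :=
  ∏ i ∈ Finset.univ.erase i₀, (θ - s i θ)

/-- `Q(θ) = c`. -/
theorem eval_separatingPolynomial_self (s : ι → (F →ₐ[ℚ] F)) (i₀ : ι) (θ : F) :
    (separatingPolynomial s i₀ θ).eval θ = separatingConstant s i₀ θ := by
  unfold separatingPolynomial separatingConstant
  rw [eval_prod]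
  simp

/-- `Q(s_j θ) = 0` for `j ≠ i₀`. -/
theorem eval_separatingPolynomial_of_ne (s : ι → (F →ₐ[ℚ] F)) (i₀ : ι) (θ : F) {j : ι}
    (hj : j ≠ i₀) : (separatingPolynomial s i₀ θ).eval (s j θ) = 0 := by
  unfold separatingPolynomial
  rw [eval_prod]
  apply Finset.prod_eq_zero (Finset.mem_erase.mpr ⟨hj, Finset.mem_univ j⟩)
  simp

/-- `c ≠ 0` when `θ` separates `i₀` from the other twists. -/
theorem separatingConstant_ne_zero (s : ι → (F →ₐ[ℚ] F)) (i₀ : ι) (θ : F)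
    (hsep : ∀ i, i ≠ i₀ → s i θ ≠ θ) : separatingConstant s i₀ θ ≠ 0 := by
  unfold separatingConstant
  rw [Finset.prod_ne_zero_iff]
  intro i hi
  have hi' : i ≠ i₀ := (Finset.mem_erase.mp hi).1
  exact sub_ne_zero.mpr (Ne.symm (hsep i hi'))

variable (A : TwoActions F V)

/-- THE ISOTYPIC PROJECTOR `e = ρ₁(c⁻¹) · Q(ρ₂ θ)`. -/
noncomputable def isotypicProjector (s : ι → (F →ₐ[ℚ] F)) (i₀ : ι) (θ : F) :
    Module.End ℚ V :=
  A.ρ₁ (separatingConstant s i₀ θ)⁻¹ *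
    (separatingPolynomial s i₀ θ).eval₂ (A.ρ₁ : F →+* Module.End ℚ V) (A.ρ₂ θ)

/-- On the `s_j`-component the projector acts as `ρ₁(c⁻¹ Q(s_j θ))`. -/
theorem isotypicProjector_apply_of_mem_component (s : ι → (F →ₐ[ℚ] F)) (i₀ : ι) (θ : F)
    {j : ι} {v : V} (hv : v ∈ A.component (s j)) :
    isotypicProjector A s i₀ θ v =
      A.ρ₁ ((separatingConstant s i₀ θ)⁻¹ * (separatingPolynomial s i₀ θ).eval (s j θ)) v := by
  unfold isotypicProjector
  rw [Module.End.mul_apply, A.eval₂_apply_of_mem_component hv, ← Module.End.mul_apply,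
    ← map_mul]

/-- THE PROJECTOR IS THE IDENTITY ON THE DIAGONAL COMPONENT (`s_{i₀} = id`, `θ` separating). -/
theorem isotypicProjector_apply_of_mem_component_self (s : ι → (F →ₐ[ℚ] F)) (i₀ : ι) (θ : F)
    (hs₀ : s i₀ = AlgHom.id ℚ F) (hsep : ∀ i, i ≠ i₀ → s i θ ≠ θ) {v : V}
    (hv : v ∈ A.component (s i₀)) : isotypicProjector A s i₀ θ v = v := by
  rw [isotypicProjector_apply_of_mem_component A s i₀ θ hv, hs₀, AlgHom.id_apply,
    eval_separatingPolynomial_self,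
    inv_mul_cancel₀ (separatingConstant_ne_zero s i₀ θ hsep), map_one]
  rfl

/-- THE PROJECTOR KILLS EVERY OTHER COMPONENT. -/
theorem isotypicProjector_apply_of_mem_component_ne (s : ι → (F →ₐ[ℚ] F)) (i₀ : ι) (θ : F)
    {j : ι} (hj : j ≠ i₀) {v : V} (hv : v ∈ A.component (s j)) :
    isotypicProjector A s i₀ θ v = 0 := by
  rw [isotypicProjector_apply_of_mem_component A s i₀ θ hv,
    eval_separatingPolynomial_of_ne s i₀ θ hj, mul_zero, map_zero]
  rfl

/-- ALGEBRAICITY: the projector lies in the ℚ-subalgebra generated by the two actions — for the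
transfer, in the ring of algebraic correspondences generated by the endomorphisms of `B`. -/
theorem isotypicProjector_mem_adjoin (s : ι → (F →ₐ[ℚ] F)) (i₀ : ι) (θ : F) :
    isotypicProjector A s i₀ θ ∈
      Algebra.adjoin ℚ (Set.range A.ρ₁ ∪ Set.range A.ρ₂ : Set (Module.End ℚ V)) := by
  unfold isotypicProjector
  apply Subalgebra.mul_mem
  · exact Algebra.subset_adjoin (Set.mem_union_left _ ⟨_, rfl⟩)
  · rw [eval₂_eq_sum_range]
    apply Subalgebra.sum_mem
    intro i _
    apply Subalgebra.mul_mem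
    · exact Algebra.subset_adjoin (Set.mem_union_left _ ⟨_, rfl⟩)
    · apply Subalgebra.pow_mem
      exact Algebra.subset_adjoin (Set.mem_union_right _ ⟨_, rfl⟩)

/-- THE ISOTYPIC DECOMPOSITION as a hypothesis: every vector is a sum of vectors of the
components `V_{s_i}` (for `F/ℚ` Galois and `s = Gal(F/ℚ)`: `F ⊗_ℚ F ≅ ∏_{σ} F`, so
`V = ⊕_σ V_σ`). -/
def IsIsotypicDecomposition (s : ι → (F →ₐ[ℚ] F)) : Prop :=
  ∀ v : V, ∃ c : ι → V, (∀ i, c i ∈ A.component (s i)) ∧ v = ∑ i, c i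

/-- Under the decomposition, the projector picks the diagonal component of a vector. -/
theorem isotypicProjector_apply_eq_component (s : ι → (F →ₐ[ℚ] F)) (i₀ : ι) (θ : F)
    (hs₀ : s i₀ = AlgHom.id ℚ F) (hsep : ∀ i, i ≠ i₀ → s i θ ≠ θ) (c : ι → V)
    (hc : ∀ i, c i ∈ A.component (s i)) :
    isotypicProjector A s i₀ θ (∑ i, c i) = c i₀ := by
  rw [map_sum, Finset.sum_eq_single i₀]
  · exact isotypicProjector_apply_of_mem_component_self A s i₀ θ hs₀ hsep (hc i₀)
  · intro j _ hj
    exact isotypicProjector_apply_of_mem_component_ne A s i₀ θ hj (hc j)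
  · intro h
    exact absurd (Finset.mem_univ i₀) h

/-- Under the decomposition, the image of the projector lies in the diagonal component. -/
theorem isotypicProjector_apply_mem (s : ι → (F →ₐ[ℚ] F)) (i₀ : ι) (θ : F)
    (hs₀ : s i₀ = AlgHom.id ℚ F) (hsep : ∀ i, i ≠ i₀ → s i θ ≠ θ)
    (hdec : IsIsotypicDecomposition A s) (v : V) :
    isotypicProjector A s i₀ θ v ∈ A.component (s i₀) := by
  obtain ⟨c, hc, rfl⟩ := hdec v
  rw [isotypicProjector_apply_eq_component A s i₀ θ hs₀ hsep c hc]
  exact hc i₀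

/-- IDEMPOTENCE under the decomposition. -/
theorem isotypicProjector_idem (s : ι → (F →ₐ[ℚ] F)) (i₀ : ι) (θ : F)
    (hs₀ : s i₀ = AlgHom.id ℚ F) (hsep : ∀ i, i ≠ i₀ → s i θ ≠ θ)
    (hdec : IsIsotypicDecomposition A s) (v : V) :
    isotypicProjector A s i₀ θ (isotypicProjector A s i₀ θ v) = isotypicProjector A s i₀ θ v :=
  isotypicProjector_apply_of_mem_component_self A s i₀ θ hs₀ hsep
    (isotypicProjector_apply_mem A s i₀ θ hs₀ hsep hdec v)

/-- THE RANGE is the diagonal component: the projector IS the projection onto the `F`-tensor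
product along the other components. -/
theorem range_isotypicProjector (s : ι → (F →ₐ[ℚ] F)) (i₀ : ι) (θ : F)
    (hs₀ : s i₀ = AlgHom.id ℚ F) (hsep : ∀ i, i ≠ i₀ → s i θ ≠ θ)
    (hdec : IsIsotypicDecomposition A s) :
    LinearMap.range (isotypicProjector A s i₀ θ) = A.component (s i₀) := by
  ext v
  constructor
  · rintro ⟨w, rfl⟩
    exact isotypicProjector_apply_mem A s i₀ θ hs₀ hsep hdec w
  · intro hv
    exact ⟨v, isotypicProjector_apply_of_mem_component_self A s i₀ θ hs₀ hsep hv⟩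

end Separating

end Summit.Ventures.HodgeRepro2.IsotypicProjector
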